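import Summits.Ventures.LatticeQCDFlow.Exactness.FlowSamplerSymmetrisation
import Summits.Ventures.LatticeQCDFlow.Exactness.Phi4FlowSquareIntegrableCeiling
import HarnessLib

/-!
# SYMMETRISATION CURES `Z₂` MODE COLLAPSE: if the flow covers every configuration OR its mirror image (`e^{−S} ≤ C·max(q̃, q̃∘σ)`), the symmetrised flow arm is uniformly ergodic — `e^{−S} ≤ 2C q̃ₛ`, every square-integrable observable summable with `τ_int ≤ 2C/Z − ½` and `ρ(k) ≤ (1 − Z/2C)ᵏ`

HONEST FRAMING: exact (Metropolis-corrected) sampling algorithms for lattice gauge theory;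
figures of merit are autocorrelation/cost numbers at stated couplings and volumes; no
continuum-physics claim.  (SCALAR calibration rung S0-A: not a gauge result.)

Venture `LatticeQCDFlow` (cell pub-lqcd), topic `Exactness`; FANOUT row 2 (`s0-phi4`, FLOW arm).
NEW WORK of the cell on the venture's MODE-COLLAPSE barrier (T4: 'mode collapse on multimodal
sectors'), composing `FlowSamplerSymmetrisation` (`q̃ₛ = ½(q̃ + q̃∘σ)`) with the weight-bound ceiling
and geometric decay of `FlowSamplerSquareIntegrableCeiling` / `…Decay` (Mengersen–Tweedie shape,
NAMED there).  A flow trained by reverse KL on a `Z₂`-symmetric double-well target typically covers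
ONE well: `sup e^{−S}/q̃` is then astronomically large or infinite on the mirror well, the weight
moment `W₂` may diverge, and then NO bounded observable has a summable series under the exact flow
arm (`IMHTauIntInfiniteOfWeightMoment.phi4Flow_forall_summable_iff`).  The observation of this
file: the symmetrised proposal only needs the flow to cover each ORBIT `{φ, −φ}` somewhere —
pointwise `e^{−S}/q̃ₛ ≤ 2·min(e^{−S}/q̃, (e^{−S}/q̃)∘σ)` — so a one-well flow with in-well weight
ratio `≤ C` becomes, symmetrised, a uniformly ergodic sampler with constant `2C`, for EVERY
observable (even or odd; no parity hypothesis).  Nothing is cited as a fact.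

## What is proved

General (`σ` a measure-preserving involution, `w ∘ σ = w`, `w, q̃ > 0`, `∫ q̃ = 1`, `Z = ∫ w`):
* `symmetrised_weightRatio_le` — `w/q̃ₛ ≤ 2 min(w/q̃, (w/q̃)∘σ)` pointwise;
* `symmetrised_weightBound_of_orbitCover` — `w ≤ C·max(q̃, q̃∘σ)` ⇒ `w ≤ 2C·q̃ₛ`;
* **`symmetrised_tauInt_le_of_orbitCover`** — then for every centred square-integrable `g` with
  `∫ g² w > 0`: the normalised series under `imhOp μ w q̃ₛ` is SUMMABLE and `τ_int^{q̃ₛ}(g) ≤ 2C/Z − ½`;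
* **`symmetrised_autocov_le_pow_of_orbitCover`** — and `C_g(k) ≤ (1 − Z/(2C))ᵏ ∫ g² w` at every lag.

Lattice (`Λ = Fin (n+1)`, every `λ > 0`, real `J`, positive measurable model density, `∫ q̃ = 1`,
ORBIT COVER `e^{−S(φ)} ≤ C·max(q̃(φ), q̃(−φ))`):
* **`phi4FlowSym_tauInt_le_of_orbitCover`** — every `f ∈ PolyObs` with `Var f > 0` (energy, `χ₂`,
  `G(0,0)`, `M`, …): summable under the symmetrised arm, `τ_intₛ(f) ≤ 2C/Z − ½`;
* **`phi4FlowSym_autocorr_le_pow_of_orbitCover`** — `ρₛ_f(k) ≤ (1 − Z/(2C))ᵏ`.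

NOT CLAIMED: any value of `C` for any network (hypothesis: in-well coverage of a trained flow); that
the un-symmetrised arm fails for a given network (the divergence statements are the tree's, under
their own hypotheses); cost accounting (two density evaluations per proposal); HMC / local arms.
-/

namespace Summit.Ventures.LatticeQCDFlow.Exactness

open Real MeasureTheory Filter Finset Set Topology
open Summit.Ventures.LatticeQCDFlow.Scoring

section General

variable {X : Type*} [MeasurableSpace X] {μ : Measure X} [SFinite μ] {w q : X → ℝ} {σ : X → X}

omit [MeasurableSpace X] in
/-- **The symmetrised importance weight is at most twice the better of the two mirror weights**:
`w(x)/q̃ₛ(x) ≤ 2·min(w(x)/q̃(x), w(σx)/q̃(σx))` (`w ∘ σ = w`, `q̃ > 0`). -/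
theorem symmetrised_weightRatio_le (hw0 : ∀ t, 0 < w t) (hw : ∀ t, w (σ t) = w t)
    (hq0 : ∀ t, 0 < q t) (x : X) :
    w x / ((q x + q (σ x)) / 2) ≤ 2 * min (w x / q x) (w (σ x) / q (σ x)) := by
  have hsum : 0 < q x + q (σ x) := add_pos (hq0 x) (hq0 _)
  have e : w x / ((q x + q (σ x)) / 2) = 2 * (w x / (q x + q (σ x))) := by
    field_simp
  rw [e, hw x, mul_min_of_nonneg _ _ (by norm_num : (0:ℝ) ≤ 2)]
  refine le_min ?_ ?_
  · exact mul_le_mul_of_nonneg_left (div_le_div_of_nonneg_left (hw0 x).le (hq0 x)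
      (le_add_of_nonneg_right (hq0 _).le)) (by norm_num)
  · exact mul_le_mul_of_nonneg_left (div_le_div_of_nonneg_left (hw0 x).le (hq0 _)
      (le_add_of_nonneg_left (hq0 x).le)) (by norm_num)

omit [MeasurableSpace X] in
/-- **ORBIT COVER ⇒ WEIGHT BOUND FOR THE SYMMETRISED MODEL**: if `w ≤ C·max(q̃, q̃∘σ)` (every orbit
`{x, σx}` has a point the flow covers to ratio `C`), then `w ≤ 2C·q̃ₛ` everywhere. -/
theorem symmetrised_weightBound_of_orbitCover (hw0 : ∀ t, 0 < w t) (hq0 : ∀ t, 0 < q t) {C : ℝ}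
    (hC : ∀ t, w t ≤ C * max (q t) (q (σ t))) (t : X) :
    w t ≤ 2 * C * ((q t + q (σ t)) / 2) := by
  have hmax : max (q t) (q (σ t)) ≤ q t + q (σ t) :=
    max_le (le_add_of_nonneg_right (hq0 _).le) (le_add_of_nonneg_left (hq0 t).le)
  have hm : 0 < max (q t) (q (σ t)) := lt_max_of_lt_left (hq0 t)
  have hC0 : 0 ≤ C := by
    by_contra h
    have : C * max (q t) (q (σ t)) < 0 := mul_neg_of_neg_of_pos (lt_of_not_ge h) hm
    linarith [hC t, hw0 t]
  calc w t ≤ C * max (q t) (q (σ t)) := hC t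
    _ ≤ C * (q t + q (σ t)) := mul_le_mul_of_nonneg_left hmax hC0
    _ = 2 * C * ((q t + q (σ t)) / 2) := by ring

/-- **SYMMETRISATION CURES `Z₂` MODE COLLAPSE (uniform ergodicity)**: `σ` a measure-preserving
involution, `w ∘ σ = w`, `q̃ > 0` normalised, ORBIT COVER `w ≤ C·max(q̃, q̃∘σ)`.  Then for every centred
square-integrable `g` (`∫ g w = 0`, `∫ g² w > 0`) the normalised autocorrelation series under the
SYMMETRISED sampler `imhOp μ w q̃ₛ` is summable and `τ_int^{q̃ₛ}(g) ≤ 2C/Z − ½` — even or odd `g`. -/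
theorem symmetrised_tauInt_le_of_orbitCover (hσ : MeasurePreserving σ μ μ) (hσσ : ∀ x, σ (σ x) = x)
    (hw0 : ∀ t, 0 < w t) (hwm : Measurable w) (hwi : Integrable w μ)
    (hq0 : ∀ t, 0 < q t) (hqm : Measurable q) (hqi : Integrable q μ) (hq1 : ∫ z, q z ∂μ = 1)
    {C : ℝ} (hC : ∀ t, w t ≤ C * max (q t) (q (σ t))) {g : X → ℝ} (hgm : Measurable g)
    (hg2 : Integrable (fun t => g t ^ 2 * w t) μ) (hg0 : ∫ t, g t * w t ∂μ = 0)
    (hP : 0 < ∫ t, g t ^ 2 * w t ∂μ) :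
    (Summable fun n => (∫ t, g t * ((imhOp μ w (fun s => (q s + q (σ s)) / 2))^[n + 1] g) t * w t ∂μ)
      / ∫ t, g t ^ 2 * w t ∂μ) ∧
    tauInt (fun n => (∫ t, g t * ((imhOp μ w (fun s => (q s + q (σ s)) / 2))^[n] g) t * w t ∂μ)
        / ∫ t, g t ^ 2 * w t ∂μ)
      ≤ 1 / ((∫ t, w t ∂μ) / (2 * C)) - 1 / 2 := by
  obtain ⟨hs0, hsm, hsi, hs1, -⟩ := symmetrised_facts hσ hσσ hq0 hqm hqi hq1
  exact imhOp_tauInt_le_weightBound_of_sq hw0 hwm hwi hs0 hsm hsi hs1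
    (fun t => symmetrised_weightBound_of_orbitCover hw0 hq0 hC t) hgm hg2 hg0 hP

/-- **… with GEOMETRIC DECORRELATION**: under the same orbit cover, for every centred square-integrable
`g` and every lag `k`: `∫ g (Kₛᵏ g) w ≤ (1 − Z/(2C))ᵏ ∫ g² w`. -/
theorem symmetrised_autocov_le_pow_of_orbitCover (hσ : MeasurePreserving σ μ μ)
    (hσσ : ∀ x, σ (σ x) = x) (hw0 : ∀ t, 0 < w t) (hwm : Measurable w) (hwi : Integrable w μ)
    (hq0 : ∀ t, 0 < q t) (hqm : Measurable q) (hqi : Integrable q μ) (hq1 : ∫ z, q z ∂μ = 1)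
    {C : ℝ} (hC : ∀ t, w t ≤ C * max (q t) (q (σ t))) {g : X → ℝ} (hgm : Measurable g)
    (hg2 : Integrable (fun t => g t ^ 2 * w t) μ) (hg0 : ∫ t, g t * w t ∂μ = 0) (k : ℕ) :
    ∫ t, g t * ((imhOp μ w (fun s => (q s + q (σ s)) / 2))^[k] g) t * w t ∂μ
      ≤ (1 - (∫ t, w t ∂μ) / (2 * C)) ^ k * ∫ t, g t ^ 2 * w t ∂μ := by
  obtain ⟨hs0, hsm, hsi, hs1, -⟩ := symmetrised_facts hσ hσσ hq0 hqm hqi hq1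
  exact imhOp_autocov_le_pow_weightBound_of_sq hw0 hwm hwi hs0 hsm hsi hs1
    (fun t => symmetrised_weightBound_of_orbitCover hw0 hq0 hC t) hgm hg2 hg0 k

end General

/-! ## The lattice: a one-well flow, symmetrised, samples both wells geometrically fast -/

section Lattice

variable {n : ℕ}

/-- **EVERY POLYNOMIAL OBSERVABLE OF LATTICE φ⁴ UNDER THE SYMMETRISED ARM OF AN ORBIT-COVERING FLOW**:
every `λ > 0`, real `J`, positive measurable model density with `∫ q̃ = 1` and
`e^{−S(φ)} ≤ C·max(q̃(φ), q̃(−φ))` for all `φ`; `f ∈ PolyObs` with `Var f > 0`.  Then under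
`imhOpPhi4 J λ q̃ₛ` the normalised series of `f` is summable and `τ_intₛ(f) ≤ 2C/Z − ½`. -/
theorem phi4FlowSym_tauInt_le_of_orbitCover {lam : ℝ} (hlam : 0 < lam)
    (J : Fin (n + 1) → Fin (n + 1) → ℝ) {q : (Fin (n + 1) → ℝ) → ℝ} (hq0 : ∀ φ, 0 < q φ)
    (hqm : Measurable q) (hqi : Integrable q) (hq1 : ∫ φ, q φ = 1) {C : ℝ}
    (hC : ∀ φ, gibbsWeight J lam φ ≤ C * max (q φ) (q (-φ))) {f : (Fin (n + 1) → ℝ) → ℝ}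
    (hf : PolyObs f) (hP : 0 < ∫ φ, (f φ - gibbsExpect J lam f) ^ 2 * gibbsWeight J lam φ) :
    (Summable fun k => (∫ φ, (f φ - gibbsExpect J lam f)
        * ((imhOpPhi4 J lam (fun ψ => (q ψ + q (-ψ)) / 2))^[k + 1]
            (fun ψ => f ψ - gibbsExpect J lam f)) φ * gibbsWeight J lam φ)
        / ∫ φ, (f φ - gibbsExpect J lam f) ^ 2 * gibbsWeight J lam φ) ∧
    tauInt (fun k => (∫ φ, (f φ - gibbsExpect J lam f)
        * ((imhOpPhi4 J lam (fun ψ => (q ψ + q (-ψ)) / 2))^[k]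
            (fun ψ => f ψ - gibbsExpect J lam f)) φ * gibbsWeight J lam φ)
        / ∫ φ, (f φ - gibbsExpect J lam f) ^ 2 * gibbsWeight J lam φ)
      ≤ 2 * C / gibbsZ J lam - 1 / 2 := by
  haveI := isNegInvariant_volume_pi (Λ := Fin (n + 1))
  obtain ⟨hs0, hsm, hsi, hs1, -⟩ := symmetrised_facts (μ := volume)
    (σ := fun ψ : Fin (n + 1) → ℝ => -ψ) (Measure.measurePreserving_neg volume) (fun φ => neg_neg φ)
    hq0 hqm hqi hq1
  exact phi4Flow_tauInt_le_weightBound_poly hlam J hs0 hsm hsi hs1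
    (fun φ => symmetrised_weightBound_of_orbitCover (σ := fun ψ : Fin (n + 1) → ℝ => -ψ)
      (fun ψ => gibbsWeight_pos J lam ψ) hq0 hC φ)
    hf hP

/-- **… AND DECORRELATES GEOMETRICALLY**: `ρₛ_f(k) ≤ (1 − Z/(2C))ᵏ` at every lag, i.e.
`∫ g (Kₛᵏ g) e^{−S} ≤ (1 − Z/(2C))ᵏ ∫ g² e^{−S}` for `g = f − ⟨f⟩`, every `f ∈ PolyObs`. -/
theorem phi4FlowSym_autocorr_le_pow_of_orbitCover {lam : ℝ} (hlam : 0 < lam)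
    (J : Fin (n + 1) → Fin (n + 1) → ℝ) {q : (Fin (n + 1) → ℝ) → ℝ} (hq0 : ∀ φ, 0 < q φ)
    (hqm : Measurable q) (hqi : Integrable q) (hq1 : ∫ φ, q φ = 1) {C : ℝ}
    (hC : ∀ φ, gibbsWeight J lam φ ≤ C * max (q φ) (q (-φ))) {f : (Fin (n + 1) → ℝ) → ℝ}
    (hf : PolyObs f) (k : ℕ) :
    ∫ φ, (f φ - gibbsExpect J lam f)
        * ((imhOpPhi4 J lam (fun ψ => (q ψ + q (-ψ)) / 2))^[k]
            (fun ψ => f ψ - gibbsExpect J lam f)) φ * gibbsWeight J lam φ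
      ≤ (1 - gibbsZ J lam / (2 * C)) ^ k * ∫ φ, (f φ - gibbsExpect J lam f) ^ 2 * gibbsWeight J lam φ := by
  haveI := isNegInvariant_volume_pi (Λ := Fin (n + 1))
  obtain ⟨hs0, hsm, hsi, hs1, -⟩ := symmetrised_facts (μ := volume)
    (σ := fun ψ : Fin (n + 1) → ℝ => -ψ) (Measure.measurePreserving_neg volume) (fun φ => neg_neg φ)
    hq0 hqm hqi hq1
  exact phi4Flow_autocov_le_pow_weightBound_poly hlam J hs0 hsm hsi hs1
    (fun φ => symmetrised_weightBound_of_orbitCover (σ := fun ψ : Fin (n + 1) → ℝ => -ψ)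
      (fun ψ => gibbsWeight_pos J lam ψ) hq0 hC φ)
    hf k

end Lattice

end Summit.Ventures.LatticeQCDFlow.Exactness
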